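import Mathlib
import HarnessLib
import Summits.NavierStokesRegularity.NavierStokesRegularity.Theorems.PoloidalWindowDoorPoloidalWindowRigidityTimeShearPressure

/-!
# Route `PoloidalWindowDoor`, crux `PoloidalWindowRigidity` (K2, stmt-NavierStokesRegularity-19708) — line «lrc-jet» v2:
# `K2 ⇐ LRC″(SPATIAL pins) ∧ (TV)` — the composition with the refuter-proof split asked by refuter1 K-a″ (STATUS 09:14Z)

Cell ns-regularity-ideate, seat ns-poloidal-K2-p3 gen 4 (stub-worker under the K2 lead ns-poloidal-K2-p1; file landed
`--supports stmt-NavierStokesRegularity-19708` as a helper; the lead registers v2 and names the stubs).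

Refuter1's K-a″ (strained crossed suction layers: an exact unsteady poloidal NS germ with Clebsch slope `Λ(t)` SPATIALLY
CONSTANT BUT TIME-DEPENDENT and vorticity without any Killing symmetry) shows that the space–time non-constancy clause of
`…K2OfLrcSlope.nonflatLiouville_of_lrc_slope` (= `stub_lrc` of Lines/lrc-jet.lean v1) cannot be discharged by a LOCAL
rigidity principle on the stratum (TV) = {∇ₓΛ ≡ 0, ∂ₜΛ ≠ 0}; (TV) needs a GLOBAL (class) Liouville theorem.  This file
re-wires the composition accordingly, into TWO stub shapes:

* `hLRC` — **LRC″ with SPATIAL pins, class form**: for every nonempty open `W` in the backward slab on which pointwise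
  `curl v ≠ 0`, `∇_h v₂ ≠ 0`, `∂₂v_h ≠ 0`, AND on which the shear slope is NOT A FUNCTION OF TIME ALONE on any nonempty
  open subset (`∀ m : ℝ → ℝ, ∀ W₁ ⊆ W` open nonempty, `∃ z ∈ W₁, ∃ b ≠ 2, ∂₂v_b(z) ≠ m(z.1) ∂_b v₂(z)` — equivalently
  `∇ₓΛ ≢ 0` on every open subset, so a certificate may pin `∇ₓΛ(z₀) ≠ 0`), a translation or rotation germ of the vorticity
  on an open set of one slice;
* `hTV` — **the (TV) Liouville theorem, class form**: if ONE negative slope function `μ : ℝ → ℝ`, real-analytic at every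
  `s < 0` and NOT constant, gives `∂₂v_b(s,·) ≡ μ(s) ∂_b v₂(s,·)` on every slice, then `v` is not backward-singular
  (the normal form of `…TimeShearPressure.timeShear_normalForm`; constant `μ` is ns-poloidal-K2-p2's p511024 and is
  excluded from the stub);
* `nonflatLiouville_of_lrc_spatial` — **class + poloidal + `hLRC` + `hTV` ⇒ `¬ IsBackwardSingularPoint v 0`.**
  Proof: degenerate slice (p510531) ∨ [non-degenerate open set `N`: time-only slope on some open `W₁ ⊆ N`
  (`…TimeShear`/`…TimeShearPressure`: `v ≡ 0`, or constant slope ↦ p514227, or the (TV) normal form ↦ `hTV`) ∨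
  `hLRC` on `N` ↦ germ ↦ p509715 / p513035].

WHAT THIS IS NOT: not a claim about Navier–Stokes regularity, not LRC″, not (TV) — the sorry-free composition of the
proposed v2 split (bears_on LADDER-NS N0 via crux K2 = stmt-19708).
-/

noncomputable section

-- the summit and its single sub-problem share the name (CONVENTIONS §1), as in every Theorems file
set_option linter.dupNamespace false

namespace Summit.NavierStokesRegularity.NavierStokesRegularity.Theorems.PoloidalWindowDoorPoloidalWindowRigidityK2OfLrcSpatial

open Set Function Filter Topology Metric
open scoped RealInnerProductSpace InnerProductSpace
open Literature.Analysis Literature.Analysis.FluidPDE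
open Summit.NavierStokesRegularity.NavierStokesRegularity.Theorems.LocalSineTubeDoorProfileAlignedWindowRigidityAncient
open Summit.NavierStokesRegularity.NavierStokesRegularity.Theorems.TubeAlternative.AnalyticPropagation
open Summit.NavierStokesRegularity.NavierStokesRegularity.Theorems.PoloidalWindowDoorPoloidalWindowRigidityLocalVorticitySymmetry
open Summit.NavierStokesRegularity.NavierStokesRegularity.Theorems.PoloidalWindowDoorPoloidalWindowRigidityDegenerateSlice
open Summit.NavierStokesRegularity.NavierStokesRegularity.Theorems.PoloidalWindowDoorPoloidalWindowRigidityOneSliceCurlAxisymmetric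
open Summit.NavierStokesRegularity.NavierStokesRegularity.Theorems.PoloidalWindowDoorPoloidalWindowRigidityK2OfLrcSlope
open Summit.NavierStokesRegularity.NavierStokesRegularity.Theorems.PoloidalWindowDoorPoloidalWindowRigidityTimeShearPressure
open Summit.NavierStokesRegularity.NavierStokesRegularity.Theorems.PoloidalWindowDoorPoloidalWindowRigidityFlat

variable {C : ℝ} {v : ℝ → EuclideanSpace ℝ (Fin 3) → EuclideanSpace ℝ (Fin 3)}

/-- **`K2 ⇐ LRC″(spatial pins) ∧ (TV)` (class form).**  Let `v` be a profile of the route's Type-I class, poloidal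
along `e₃` on every slice.  Assume
* `hLRC`: for every nonempty open `W` in the backward slab on which pointwise `curl v ≠ 0`, `∇_h v₂ ≠ 0`, `∂₂v_h ≠ 0`,
  and on which the shear slope is not a function of time alone on any nonempty open subset, there are a slice `s < 0` and
  a nonempty open `U` carrying a translation germ (`D(curl v(s))[e] = 0`, `e ≠ 0`) or a rotation germ about some vertical
  axis (`J curl v(s)(y) = D(curl v(s))(y)[J(y − c)]`);
* `hTV`: if a negative, everywhere real-analytic, non-constant slope function `μ` gives `∂₂v_b(s,·) ≡ μ(s)∂_b v₂(s,·)`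
  (`b = 0,1`) on every slice `s < 0`, then `v` is not backward-singular.
Then `v` is not backward-singular at the apex. -/
theorem nonflatLiouville_of_lrc_spatial (hrate : HasTypeITimeDecay C v)
    (hcont : ContinuousOn (uncurry v) (Iio (0 : ℝ) ×ˢ univ))
    (hmild : ∀ s t : ℝ, s < t → t < 0 → ∀ x,
      v t x = UnboundedOperators.heatExtension (v s) (t - s) x - oseenDuhamel 1 s v v t x)
    (hdiv : ∀ t < 0, VectorCalculus.IsDivFree (v t))
    (hpol : ∀ s < 0, ∀ y, ⟪curl (v s) y, EuclideanSpace.single 2 1⟫_ℝ = 0)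
    (hLRC : ∀ W : Set (ℝ × EuclideanSpace ℝ (Fin 3)), IsOpen W → W.Nonempty → W ⊆ Iio (0 : ℝ) ×ˢ univ →
      (∀ z ∈ W, curl (v z.1) z.2 ≠ 0 ∧
        (fderiv ℝ (v z.1) z.2 (EuclideanSpace.single 0 1) 2 ≠ 0 ∨ fderiv ℝ (v z.1) z.2 (EuclideanSpace.single 1 1) 2 ≠ 0) ∧
        (fderiv ℝ (v z.1) z.2 (EuclideanSpace.single 2 1) 0 ≠ 0 ∨ fderiv ℝ (v z.1) z.2 (EuclideanSpace.single 2 1) 1 ≠ 0)) →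
      (∀ m : ℝ → ℝ, ∀ W₁ : Set (ℝ × EuclideanSpace ℝ (Fin 3)), W₁ ⊆ W → IsOpen W₁ → W₁.Nonempty →
        ∃ z ∈ W₁, ∃ b : Fin 3, b ≠ 2 ∧
          fderiv ℝ (v z.1) z.2 (EuclideanSpace.single 2 1) b ≠ m z.1 * fderiv ℝ (v z.1) z.2 (EuclideanSpace.single b 1) 2) →
      ∃ s : ℝ, s < 0 ∧ ∃ U : Set (EuclideanSpace ℝ (Fin 3)), IsOpen U ∧ U.Nonempty ∧
        ((∃ e : EuclideanSpace ℝ (Fin 3), e ≠ 0 ∧ ∀ y ∈ U, fderiv ℝ (curl (v s)) y e = 0) ∨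
         (∃ c : EuclideanSpace ℝ (Fin 3), ∀ y ∈ U,
            rotGen (curl (v s) y) = fderiv ℝ (curl (v s)) y (rotGen (y - c)))))
    (hTV : ∀ μ : ℝ → ℝ, (∀ s < 0, μ s < 0) → (∀ s < 0, AnalyticAt ℝ μ s) →
      (∃ s₁ s₂ : ℝ, s₁ < 0 ∧ s₂ < 0 ∧ μ s₁ ≠ μ s₂) →
      (∀ s < 0, ∀ y, ∀ b : Fin 3, b ≠ 2 →
        fderiv ℝ (v s) y (EuclideanSpace.single 2 1) b = μ s * fderiv ℝ (v s) y (EuclideanSpace.single b 1) 2) →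
      ¬ IsBackwardSingularPoint v 0) :
    ¬ IsBackwardSingularPoint v 0 := by
  -- the slab and the joint continuity of `curl v` and of the Jacobian entries on it
  set O : Set (ℝ × EuclideanSpace ℝ (Fin 3)) := Iio (0 : ℝ) ×ˢ univ with hO
  have hOo : IsOpen O := isOpen_Iio.prod isOpen_univ
  have hanV := analyticOnNhd_uncurry hcont (bdd_of_hasTypeITimeDecay hrate) hmild
  have hcurlc : ContinuousOn (uncurry fun s y => curl (v s) y) O := (analyticOnNhd_uncurry_curl hanV isOpen_Iio).continuousOn
  have hent : ∀ (j i : Fin 3), ContinuousOn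
      (fun z : ℝ × EuclideanSpace ℝ (Fin 3) => fderiv ℝ (v z.1) z.2 (EuclideanSpace.single j 1) i) O :=
    fun j i => continuousOn_fderiv_entry hrate hcont hmild j i
  -- the non-degeneracy predicate
  set ND : ℝ × EuclideanSpace ℝ (Fin 3) → Prop := fun z => curl (v z.1) z.2 ≠ 0 ∧
      (fderiv ℝ (v z.1) z.2 (EuclideanSpace.single 0 1) 2 ≠ 0 ∨ fderiv ℝ (v z.1) z.2 (EuclideanSpace.single 1 1) 2 ≠ 0) ∧
      (fderiv ℝ (v z.1) z.2 (EuclideanSpace.single 2 1) 0 ≠ 0 ∨ fderiv ℝ (v z.1) z.2 (EuclideanSpace.single 2 1) 1 ≠ 0)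
    with hND
  by_cases hdeg : ∀ y : EuclideanSpace ℝ (Fin 3), ¬ ND (-1, y)
  · -- every point of the slice `s = −1` is degenerate: nsreg-p7's trichotomy
    refine nonflatLiouville_of_pointwise_degenerate_slice hrate hcont hmild hdiv (by norm_num : (-1 : ℝ) < 0)
      (hpol (-1) (by norm_num)) fun y => ?_
    have h := hdeg y
    simp only [hND, not_and_or, not_or, not_not] at h
    rcases h with h | h | h
    · exact Or.inl h
    · exact Or.inr (Or.inl ⟨h.1, h.2⟩)
    · exact Or.inr (Or.inr ⟨h.1, h.2⟩)
  · -- the non-degenerate part `N` of the slab is a nonempty open space–time set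
    push Not at hdeg
    obtain ⟨y₀, hy₀⟩ := hdeg
    set N : Set (ℝ × EuclideanSpace ℝ (Fin 3)) := {z | z ∈ O ∧ ND z} with hN
    have hNO : N ⊆ O := fun z hz => hz.1
    have hNne : N.Nonempty := ⟨(-1, y₀), ⟨mk_mem_prod (by norm_num : (-1 : ℝ) ∈ Iio 0) (mem_univ _), hy₀⟩⟩
    have hNopen : IsOpen N := by
      rw [isOpen_iff_mem_nhds]
      rintro z ⟨hzO, hA, hB, hCc⟩
      have hOz : O ∈ 𝓝 z := hOo.mem_nhds hzO
      have eA : ∀ᶠ w in 𝓝 z, curl (v w.1) w.2 ≠ 0 :=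
        ((hcurlc z hzO).continuousAt hOz).eventually_ne hA
      have eB : ∀ᶠ w in 𝓝 z, fderiv ℝ (v w.1) w.2 (EuclideanSpace.single 0 1) 2 ≠ 0 ∨
          fderiv ℝ (v w.1) w.2 (EuclideanSpace.single 1 1) 2 ≠ 0 := by
        rcases hB with hB | hB
        · exact (((hent 0 2) z hzO).continuousAt hOz |>.eventually_ne hB).mono fun w hw => Or.inl hw
        · exact (((hent 1 2) z hzO).continuousAt hOz |>.eventually_ne hB).mono fun w hw => Or.inr hw
      have eC : ∀ᶠ w in 𝓝 z, fderiv ℝ (v w.1) w.2 (EuclideanSpace.single 2 1) 0 ≠ 0 ∨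
          fderiv ℝ (v w.1) w.2 (EuclideanSpace.single 2 1) 1 ≠ 0 := by
        rcases hCc with hCc | hCc
        · exact (((hent 2 0) z hzO).continuousAt hOz |>.eventually_ne hCc).mono fun w hw => Or.inl hw
        · exact (((hent 2 1) z hzO).continuousAt hOz |>.eventually_ne hCc).mono fun w hw => Or.inr hw
      have eO : ∀ᶠ w in 𝓝 z, w ∈ O := hOz
      filter_upwards [eO, eA, eB, eC] with w hwO hwA hwB hwC
      exact ⟨hwO, hwA, hwB, hwC⟩
    -- dichotomy: time-only slope somewhere in `N`, or nowhere
    by_cases hloc : ∃ m : ℝ → ℝ, ∃ W₁ : Set (ℝ × EuclideanSpace ℝ (Fin 3)), W₁ ⊆ N ∧ IsOpen W₁ ∧ W₁.Nonempty ∧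
        ∀ z ∈ W₁, ∀ b : Fin 3, b ≠ 2 →
          fderiv ℝ (v z.1) z.2 (EuclideanSpace.single 2 1) b = m z.1 * fderiv ℝ (v z.1) z.2 (EuclideanSpace.single b 1) 2
    · obtain ⟨m, W₁, hW₁N, hW₁o, hW₁ne, hW₁⟩ := hloc
      rcases timeShear_normalForm hrate hcont hmild hdiv hpol hW₁o hW₁ne (hW₁N.trans hNO) hW₁ with hzero | ⟨μ, hμneg, hμan, hμid⟩
      · exact not_backwardSingular_of_zero hzero
      · by_cases hconst : ∃ s₁ s₂ : ℝ, s₁ < 0 ∧ s₂ < 0 ∧ μ s₁ ≠ μ s₂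
        · exact hTV μ hμneg hμan hconst hμid
        · -- a constant slope function: ns-poloidal-K2-p2's p511024 via `…K2OfLrcSlope`
          push Not at hconst
          refine nonflatLiouville_of_constantShear_real hrate hcont hmild hdiv hpol (μ (-1)) fun s hs y b hb => ?_
          rw [hμid s hs y b hb, hconst s (-1) hs (by norm_num)]
    · push Not at hloc
      have hnc : ∀ m : ℝ → ℝ, ∀ W₁ : Set (ℝ × EuclideanSpace ℝ (Fin 3)), W₁ ⊆ N → IsOpen W₁ → W₁.Nonempty →
          ∃ z ∈ W₁, ∃ b : Fin 3, b ≠ 2 ∧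
            fderiv ℝ (v z.1) z.2 (EuclideanSpace.single 2 1) b ≠
              m z.1 * fderiv ℝ (v z.1) z.2 (EuclideanSpace.single b 1) 2 := by
        intro m W₁ h1 h2 h3
        obtain ⟨z, hz, b, hb, hne⟩ := hloc m W₁ h1 h2 h3
        exact ⟨z, hz, b, hb, hne⟩
      obtain ⟨s, hs, U, hUo, hUne, hsym⟩ := hLRC N hNopen hNne hNO (fun z hz => hz.2) hnc
      rcases hsym with ⟨e, he, htr⟩ | ⟨c, hrot⟩
      · exact nonflatLiouville_of_local_curl_translation hrate hcont hmild hdiv hs he hUo hUne htr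
      · exact nonflatLiouville_of_curl_rotDefect_eq_zero_on_open hrate hcont hmild hdiv hpol c hs hUo hUne hrot

/-- **The spatial-pin form implies the space–time form.**  If the slope is not a function of time alone on any open
subset of `W`, then a fortiori it is not locally constant there — so `hLRC` of `…K2OfLrcSlope.nonflatLiouville_of_lrc_slope`
(space–time non-constancy, v1's `stub_lrc`) implies the `hLRC` above; recorded for the lead's bookkeeping. -/
theorem lrc_spatial_of_lrc_spacetime
    (hLRC : ∀ W : Set (ℝ × EuclideanSpace ℝ (Fin 3)), IsOpen W → W.Nonempty → W ⊆ Iio (0 : ℝ) ×ˢ univ →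
      (∀ z ∈ W, curl (v z.1) z.2 ≠ 0 ∧
        (fderiv ℝ (v z.1) z.2 (EuclideanSpace.single 0 1) 2 ≠ 0 ∨ fderiv ℝ (v z.1) z.2 (EuclideanSpace.single 1 1) 2 ≠ 0) ∧
        (fderiv ℝ (v z.1) z.2 (EuclideanSpace.single 2 1) 0 ≠ 0 ∨ fderiv ℝ (v z.1) z.2 (EuclideanSpace.single 2 1) 1 ≠ 0)) →
      (∀ μ : ℝ, ∀ W₁ : Set (ℝ × EuclideanSpace ℝ (Fin 3)), W₁ ⊆ W → IsOpen W₁ → W₁.Nonempty →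
        ∃ z ∈ W₁, ∃ b : Fin 3, b ≠ 2 ∧
          fderiv ℝ (v z.1) z.2 (EuclideanSpace.single 2 1) b ≠ μ * fderiv ℝ (v z.1) z.2 (EuclideanSpace.single b 1) 2) →
      ∃ s : ℝ, s < 0 ∧ ∃ U : Set (EuclideanSpace ℝ (Fin 3)), IsOpen U ∧ U.Nonempty ∧
        ((∃ e : EuclideanSpace ℝ (Fin 3), e ≠ 0 ∧ ∀ y ∈ U, fderiv ℝ (curl (v s)) y e = 0) ∨
         (∃ c : EuclideanSpace ℝ (Fin 3), ∀ y ∈ U,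
            rotGen (curl (v s) y) = fderiv ℝ (curl (v s)) y (rotGen (y - c))))) :
    ∀ W : Set (ℝ × EuclideanSpace ℝ (Fin 3)), IsOpen W → W.Nonempty → W ⊆ Iio (0 : ℝ) ×ˢ univ →
      (∀ z ∈ W, curl (v z.1) z.2 ≠ 0 ∧
        (fderiv ℝ (v z.1) z.2 (EuclideanSpace.single 0 1) 2 ≠ 0 ∨ fderiv ℝ (v z.1) z.2 (EuclideanSpace.single 1 1) 2 ≠ 0) ∧
        (fderiv ℝ (v z.1) z.2 (EuclideanSpace.single 2 1) 0 ≠ 0 ∨ fderiv ℝ (v z.1) z.2 (EuclideanSpace.single 2 1) 1 ≠ 0)) →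
      (∀ m : ℝ → ℝ, ∀ W₁ : Set (ℝ × EuclideanSpace ℝ (Fin 3)), W₁ ⊆ W → IsOpen W₁ → W₁.Nonempty →
        ∃ z ∈ W₁, ∃ b : Fin 3, b ≠ 2 ∧
          fderiv ℝ (v z.1) z.2 (EuclideanSpace.single 2 1) b ≠ m z.1 * fderiv ℝ (v z.1) z.2 (EuclideanSpace.single b 1) 2) →
      ∃ s : ℝ, s < 0 ∧ ∃ U : Set (EuclideanSpace ℝ (Fin 3)), IsOpen U ∧ U.Nonempty ∧
        ((∃ e : EuclideanSpace ℝ (Fin 3), e ≠ 0 ∧ ∀ y ∈ U, fderiv ℝ (curl (v s)) y e = 0) ∨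
         (∃ c : EuclideanSpace ℝ (Fin 3), ∀ y ∈ U,
            rotGen (curl (v s) y) = fderiv ℝ (curl (v s)) y (rotGen (y - c)))) :=
  fun W hW hWne hWs hnd hnc => hLRC W hW hWne hWs hnd fun μ W₁ h1 h2 h3 => hnc (fun _ => μ) W₁ h1 h2 h3

end Summit.NavierStokesRegularity.NavierStokesRegularity.Theorems.PoloidalWindowDoorPoloidalWindowRigidityK2OfLrcSpatial

end
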